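import Summits.NavierStokesRegularity.FluidComputer.PalasekTowerRegisterGlobalAt
import Summits.NavierStokesRegularity.FluidComputer.PalasekTowerRegisterPushBudget
import Summits.NavierStokesRegularity.FluidComputer.PalasekTowerRegisterQuiet
import Summits.NavierStokesRegularity.FluidComputer.PalasekTowerLedger

/-!
# The window arithmetic of the TUNED rates `(2^24, 33/32, 12/5, 49/20)`: geometric windows, clock witness,
# push budget — the registered schedule class at `TowerRates.tuned` is NONEMPTY

Cell `ns-blowup`, seat `ns-blowup-ecbridge-3` (g8); GROUP C «BRIDGE SUPPORT» of the route
`PalasekTowerBreakdown` after the RE-BASE (rev 19, 2026-08-27T10:23Z): the live cruxes are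
`EpisodeBaseT := EpisodeBaseGAt TowerRates.tuned` (stmt-NavierStokesRegularity-20303),
`HeredityAtOneT`, `HeredityFromTwoT`. LABEL: E–C typing / BC7 bookkeeping (KERNEL: theorems only).
WHAT THIS IS NOT: not Navier–Stokes evidence — rate arithmetic of one rates record and a schedule with
ZERO datum and ZERO force; no stage, no flow, nothing about the cruxes.

`EpisodeBaseT` reads `∃ S : Schedule tuned, S.Pins 8 (6/5) ∧ S.Rigid ∧ S.Quiet ∧ Nonempty (Stage …)`. The
tree held the schedule-level non-vacuity only at `wide` (`TowerRates.exists_registered_schedule`,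
`PalasekTowerRegisterWindow.lean`: `w_{k+1} ≤ w_k/3`, `A_k w_{k+1} ≤ (2/3)·32`). This file supplies the
tuned twins, in the hypothesis shape of the generic window schedule `Schedule.ofWindows` and of any
tuned box schedule:

* (generic) `TowerRates.window_succ` (`w_{k+1} = w_k · b / N_k^{β(b−1)}`), `TowerRates.A_mul_window_succ`
  (`A_k w_{k+1} = 4b³β log N_k / N_k^{β(b−1)}`), `TowerRates.impulse_of_window_le` (a push constant
  `c ≤ 1` passes the impulse pin `Λ = 8` once `24 w_k ≤ 1` and `2Y_k ≤ Y_{k+1}`);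
* (tuned) `β(b−1) = 3/40`, `log N_k ≥ 24 log 2 ≥ 16.6355`, `N_k^{3/40} ≥ 2^{9/5} ≥ 99/32`;
  **`tuned_window_geo`** `w_{k+1} ≤ w_k/3`; **`tuned_window_clock`** `A_k w_{k+1} ≤ (2/3)·128`
  (`10.53·L·e^{−0.075L} ≤ 85.3` for `L ≥ 16.63`, cubic Taylor certificate); `tuned_Y_ge` (`Y_k ≥ 2^24`),
  **`tuned_window_le`** (`24 w_k ≤ 1`), **`tuned_Y_mul_window_le`** (`Y_k w_k ≤ 1/4`);
* **`tuned_exists_registered_schedule`**: `∃ S : Schedule tuned, S.Pins 8 (6/5) ∧ S.Rigid ∧ ∀ t, S.f t = 0`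
  (clock witness `c₃ = 128`) and **`tuned_exists_registered_quiet_schedule`** (`… ∧ S.Quiet`): the
  schedule half of `EpisodeBaseT`'s `∃` is inhabited; its content is the STAGE.

References: S. Palasek, arXiv:2605.13827 §3.3 (the schedule of switching times), Rem. 1.5
[cite: Palasek2026ElementaryModel, §3.3].
-/

noncomputable section

namespace Summit.NavierStokesRegularity.FluidComputer.PalasekTowerClayBridge

open Set Filter Topology Function
open Literature.Analysis.FluidPDE

namespace TowerRates

/-! ## §1 Generic window arithmetic -/

section Generic

variable (R : TowerRates)

/-- **The window recursion**: `w_{k+1} = w_k · b / N_k^{β(b−1)}` (`log N_{k+2} = b log N_{k+1}`,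
`A_{k+1} = A_k N_k^{β(b−1)}`). [cite: Palasek2026ElementaryModel, §3.3] -/
theorem window_succ (k : ℕ) :
    R.window (k + 1) = R.window k * R.b / R.N k ^ (R.β * (R.b - 1)) := by
  have hA : R.A k ≠ 0 := (R.A_pos k).ne'
  have hP : R.N k ^ (R.β * (R.b - 1)) ≠ 0 := (Real.rpow_pos_of_pos (R.N_pos k) _).ne'
  unfold TowerRates.window
  rw [show k + 1 + 1 = (k + 1) + 1 from rfl, R.log_N_succ (k + 1), R.A_succ k]
  field_simp

/-- **The clock product**: `A_k w_{k+1} = 4 b³ β log N_k / N_k^{β(b−1)}`. [cite: Palasek2026ElementaryModel, §3.3] -/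
theorem A_mul_window_succ (k : ℕ) :
    R.A k * R.window (k + 1) = 4 * R.b ^ 3 * R.β * Real.log (R.N k) / R.N k ^ (R.β * (R.b - 1)) := by
  have hA : R.A k ≠ 0 := (R.A_pos k).ne'
  have hP : R.N k ^ (R.β * (R.b - 1)) ≠ 0 := (Real.rpow_pos_of_pos (R.N_pos k) _).ne'
  unfold TowerRates.window
  rw [show k + 1 + 1 = (k + 1) + 1 from rfl, R.log_N_succ (k + 1), R.log_N_succ k, R.A_succ k]
  field_simp

/-- **The impulse pin from a small window**: with the registered band `2Y_k ≤ Y_{k+1}` and `24 w_k ≤ 1`,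
every push constant `c ≤ 1` obeys `8 (c Y_k) w_k ≤ Y_{k+1} − (5/3) Y_k` (the impulse clause of
`Schedule.Pins 8 θ` on a rigid schedule, whose gap is `w_k` and whose constants are `c₁ = 1`, `c₂ = 5/3`).
[folklore] -/
theorem impulse_of_window_le {k : ℕ} (hsep : 2 * R.Y k ≤ R.Y (k + 1)) (hw : 24 * R.window k ≤ 1)
    {c : ℝ} (hc1 : c ≤ 1) :
    8 * (c * R.Y k) * R.window k ≤ 1 * R.Y (k + 1) - 5 / 3 * R.Y k := by
  have hY : 0 < R.Y k := Real.rpow_pos_of_pos (R.N_pos k) _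
  have hw0 : 0 < R.window k := R.window_pos k
  have h1 : 8 * (c * R.Y k) * R.window k ≤ 8 * R.Y k * R.window k := by
    have : c * R.Y k ≤ 1 * R.Y k := mul_le_mul_of_nonneg_right hc1 hY.le
    nlinarith
  have h2 : 8 * R.Y k * R.window k ≤ R.Y k / 3 := by
    have : R.Y k * (24 * R.window k) ≤ R.Y k * 1 := mul_le_mul_of_nonneg_left hw hY.le
    linarith
  linarith

end Generic

/-! ## §2 The tuned rates: exponents and logarithms -/

/-- `β(b−1) = 3/40` on the tuned rates. [folklore] -/
theorem tuned_decayExp_eq : tuned.β * (tuned.b - 1) = 3 / 40 := by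
  simp only [tuned]; norm_num

/-- `4 b³ β = 107811/10240 ≈ 10.53` on the tuned rates. [folklore] -/
theorem tuned_clockConst_eq : 4 * tuned.b ^ 3 * tuned.β = 107811 / 10240 := by
  simp only [tuned]; norm_num

/-- `4 b² β = 3267/320 ≈ 10.21` on the tuned rates. [folklore] -/
theorem tuned_pushConst_eq : 4 * tuned.b ^ 2 * tuned.β = 3267 / 320 := by
  simp only [tuned]; norm_num

/-- `log N₀ = 24 log 2` on the tuned rates. [folklore] -/
theorem tuned_log_N₀_eq : Real.log tuned.N₀ = 24 * Real.log 2 := by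
  rw [tuned_N₀_eq, Real.log_rpow two_pos]

/-- `log N_k ≥ 24 log 2 ≥ 16.6355` on the tuned rates. [folklore] -/
theorem tuned_log_N_ge (k : ℕ) : (166355 : ℝ) / 10000 ≤ Real.log (tuned.N k) := by
  have h1 : Real.log tuned.N₀ ≤ Real.log (tuned.N k) :=
    Real.log_le_log (lt_trans one_pos tuned.one_lt_N₀) (tuned.N₀_le_N k)
  rw [tuned_log_N₀_eq] at h1
  have h2 := Real.log_two_gt_d9
  linarith

/-- `2^24 ≤ N_k` on the tuned rates. [folklore] -/
theorem tuned_N_ge (k : ℕ) : (2 : ℝ) ^ (24 : ℝ) ≤ tuned.N k := by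
  rw [← tuned_N₀_eq]; exact tuned.N₀_le_N k

/-- `N_k^{3/40} ≥ 2^{9/5} ≥ 99/32` on the tuned rates. [folklore] -/
theorem tuned_rpow_decayExp_ge (k : ℕ) : (99 : ℝ) / 32 ≤ tuned.N k ^ (tuned.β * (tuned.b - 1)) := by
  rw [tuned_decayExp_eq]
  have h1 : ((2 : ℝ) ^ (24 : ℝ)) ^ ((3 : ℝ) / 40) ≤ tuned.N k ^ ((3 : ℝ) / 40) :=
    Real.rpow_le_rpow (by positivity) (tuned_N_ge k) (by norm_num)
  have h2 : ((2 : ℝ) ^ (24 : ℝ)) ^ ((3 : ℝ) / 40) = (2 : ℝ) ^ ((9 : ℝ) / 5) := by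
    rw [← Real.rpow_mul (by norm_num)]; norm_num
  rw [h2] at h1
  refine le_trans ?_ h1
  -- `(99/32)^5 ≤ 2^9`
  have h3 : ((99 : ℝ) / 32) ^ (5 : ℕ) ≤ ((2 : ℝ) ^ ((9 : ℝ) / 5)) ^ (5 : ℕ) := by
    rw [← Real.rpow_natCast ((2 : ℝ) ^ ((9 : ℝ) / 5)), ← Real.rpow_mul (by norm_num)]
    norm_num
  exact (pow_le_pow_iff_left₀ (by norm_num) (by positivity) (by norm_num)).1 h3

/-! ## §3 The tuned rates: geometric windows and the clock witness -/

/-- **Geometric domination on the tuned rates**: `w_{k+1} ≤ w_k / 3`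
(`w_{k+1}/w_k = b N_k^{−3/40} ≤ (33/32)/(99/32) = 1/3`). [folklore] -/
theorem tuned_window_geo (k : ℕ) : tuned.window (k + 1) ≤ 1 / 3 * tuned.window k := by
  rw [tuned.window_succ k]
  have hw : 0 < tuned.window k := tuned.window_pos k
  have hP : (99 : ℝ) / 32 ≤ tuned.N k ^ (tuned.β * (tuned.b - 1)) := tuned_rpow_decayExp_ge k
  have hP0 : 0 < tuned.N k ^ (tuned.β * (tuned.b - 1)) := Real.rpow_pos_of_pos (tuned.N_pos k) _
  have hb : tuned.b = 33 / 32 := rfl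
  rw [div_le_iff₀ hP0]
  have hmul := mul_le_mul_of_nonneg_left hP hw.le
  rw [hb] at hmul ⊢
  nlinarith

/-- **Clock arithmetic on the tuned rates**: `A_k w_{k+1} ≤ (2/3) · 128`, i.e.
`10.53 · L · e^{−(3/40) L} ≤ 85.33` for `L = log N_k ≥ 16.6355` (`e^{x} ≥` cubic Taylor). [folklore] -/
theorem tuned_window_clock (k : ℕ) : tuned.A k * tuned.window (k + 1) ≤ (1 - 1 / 3) * 128 := by
  rw [tuned.A_mul_window_succ k, tuned_clockConst_eq, tuned_decayExp_eq]
  have hL := tuned_log_N_ge k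
  set L : ℝ := Real.log (tuned.N k) with hLdef
  have hNexp : tuned.N k ^ ((3 : ℝ) / 40) = Real.exp (3 / 40 * L) := by
    rw [Real.rpow_def_of_pos (tuned.N_pos k), hLdef]; ring_nf
  rw [hNexp]
  set w : ℝ := 3 / 40 * L with hw
  have hw0 : 0 ≤ w := by rw [hw]; linarith
  have hexp : 1 + w + w ^ 2 / 2 + w ^ 3 / 6 ≤ Real.exp w := by
    have h := Real.sum_le_exp_of_nonneg hw0 4
    have hs : ∑ i ∈ Finset.range 4, w ^ i / (i.factorial : ℝ) = 1 + w + w ^ 2 / 2 + w ^ 3 / 6 := by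
      simp [Finset.sum_range_succ, Nat.factorial]
    linarith [hs]
  have hEpos : 0 < Real.exp w := Real.exp_pos _
  rw [div_le_iff₀ hEpos]
  -- polynomial certificate on `L ≥ 16.6355`
  have h1 : 0 ≤ L - 166355 / 10000 := by linarith
  have h2 : 0 ≤ (L - 166355 / 10000) ^ 2 := sq_nonneg _
  have h3 : 0 ≤ (L - 166355 / 10000) ^ 3 := by positivity
  have hpoly : (107811 / 10240 : ℝ) * L ≤ (1 - 1 / 3) * 128 * (1 + w + w ^ 2 / 2 + w ^ 3 / 6) := by
    rw [hw]
    nlinarith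
  nlinarith

/-! ## §4 The tuned rates: the push budget -/

/-- `Y_k ≥ Y₀ = 2^{168/5} ≥ 2^24` on the tuned rates. [folklore] -/
theorem tuned_Y_ge (k : ℕ) : (2 : ℝ) ^ (24 : ℝ) ≤ tuned.Y k := by
  refine le_trans ?_ (tuned.Y_zero_le k)
  have hN₀ : tuned.N 0 = (2 : ℝ) ^ (24 : ℝ) := by
    rw [← tuned_N₀_eq]; simp [TowerRates.N]
  have hβ : tuned.β = 12 / 5 := rfl
  simp only [TowerRates.Y]
  rw [hN₀, hβ, ← Real.rpow_mul (by norm_num)]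
  exact Real.rpow_le_rpow_of_exponent_le (by norm_num) (by norm_num)

/-- **Small windows on the tuned rates**: `24 w_k ≤ 1` (`w_k = 4b²β (log N_k/N_k)/Y_k ≤ 10.21/2^24`).
[folklore] -/
theorem tuned_window_le (k : ℕ) : 24 * tuned.window k ≤ 1 := by
  have hY : 0 < tuned.Y k := Real.rpow_pos_of_pos (tuned.N_pos k) _
  have hYw := tuned.Y_mul_window k
  rw [tuned_pushConst_eq] at hYw
  have hN : 0 < tuned.N k := tuned.N_pos k
  have hlog : Real.log (tuned.N k) / tuned.N k ≤ 1 := by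
    rw [div_le_one hN]
    exact (Real.log_le_sub_one_of_pos hN).trans (by linarith)
  have hYge := tuned_Y_ge k
  have h24 : (2 : ℝ) ^ (24 : ℝ) = 16777216 := by norm_num
  rw [h24] at hYge
  -- `24 · Y_k · w_k ≤ 24 · 3267/320 ≤ Y_k`
  have h1 : tuned.Y k * (24 * tuned.window k) ≤ tuned.Y k * 1 := by
    have : tuned.Y k * (24 * tuned.window k) = 24 * (3267 / 320 * (Real.log (tuned.N k) / tuned.N k)) := by
      rw [← hYw]; ring
    rw [this]
    nlinarith
  exact le_of_mul_le_mul_left h1 hY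

/-- **The push budget on the tuned rates**: `Y_k w_k = 4b²β log N_k / N_k ≤ 1/4`
(`log x / x` antitone on `[e, ∞)`, `N_k ≥ 2^24`). [folklore] -/
theorem tuned_Y_mul_window_le (k : ℕ) : tuned.Y k * tuned.window k ≤ 1 / 4 := by
  rw [tuned.Y_mul_window k, tuned_pushConst_eq]
  have hNk := tuned_N_ge k
  have h24 : (2 : ℝ) ^ (24 : ℝ) = 16777216 := by norm_num
  rw [h24] at hNk
  have he : Real.exp 1 ≤ (16777216 : ℝ) := by
    have := Real.exp_one_lt_three
    linarith
  have h := Real.log_div_self_antitoneOn (a := 16777216) (b := tuned.N k) he (le_trans he hNk) hNk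
  have h' : Real.log (tuned.N k) / tuned.N k ≤ Real.log 16777216 / 16777216 := by simpa using h
  have hlog : Real.log (16777216 : ℝ) = 24 * Real.log 2 := by
    rw [show (16777216 : ℝ) = 2 ^ 24 by norm_num, Real.log_pow]
    norm_num
  rw [hlog] at h'
  have h3 := Real.log_two_lt_d9
  nlinarith

/-- On the tuned rates every push constant `c ≤ 1` passes the impulse pin `Λ = 8` on the rigid
window: `8 (c Y_k) w_k ≤ Y_{k+1} − (5/3) Y_k`. [folklore] -/
theorem tuned_impulse_le (k : ℕ) {c : ℝ} (hc1 : c ≤ 1) :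
    8 * (c * tuned.Y k) * tuned.window k ≤ 1 * tuned.Y (k + 1) - 5 / 3 * tuned.Y k :=
  tuned.impulse_of_window_le (tuned_sep k) (tuned_window_le k) hc1

/-! ## §5 The registered schedule class at `tuned` is nonempty -/

/-- **The registered schedule class of the RE-BASED route is NONEMPTY**: some schedule on the tuned
rates satisfies `Schedule.Pins 8 (6/5)` and `Schedule.Rigid` (the window schedule with zero datum and
zero force, clock witness `c₃ = 128`, ratio `r = 1/3`). [folklore] -/
theorem tuned_exists_registered_schedule :
    ∃ S : Schedule tuned, S.Pins 8 (6 / 5) ∧ S.Rigid ∧ ∀ t, S.f t = 0 :=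
  Schedule.exists_pins_rigid_of_windows (by norm_num) (by norm_num) tuned_window_geo
    tuned_window_clock tuned_sep 8

/-- **… and QUIET**: `∃ S : Schedule tuned, S.Pins 8 (6/5) ∧ S.Rigid ∧ S.Quiet` — the schedule half
of `EpisodeBaseGAt TowerRates.tuned` is inhabited (its content is the `Stage`). [folklore] -/
theorem tuned_exists_registered_quiet_schedule :
    ∃ S : Schedule tuned, S.Pins 8 (6 / 5) ∧ S.Rigid ∧ S.Quiet := by
  obtain ⟨S, hP, hR, hf⟩ := tuned_exists_registered_schedule
  exact ⟨S, hP, hR, Schedule.Quiet.of_force_eq_zero hf⟩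

end TowerRates

end Summit.NavierStokesRegularity.FluidComputer.PalasekTowerClayBridge

end
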